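import Summits.Ventures.MM22.Rank333.ProfileCertL494Final
import Summits.Ventures.MM22.Rank333.Lift333O487
import Summits.Ventures.MM22.Rank333.Lift333O488
import Summits.Ventures.MM22.Rank333.Lift333O490
import Summits.Ventures.MM22.Rank333.Lift333O491
import HarnessLib

/-!
# MM22 venture — PROFILE-CERT kernel replay (sub-instance 494): `Cert 3 3 3 [84] 20` UNCONDITIONAL

HONEST FRAMING (cell `pub-mm22`, seat bench g6; V4-MENU item (0′)). The four cited planes of the 494 @ 20 certificate
(orbits 487, 488, 490, 491 of Wang's `⟨3,3,3⟩/𝔽₂` table at 19) are p3 g4's kernel replays `Lift333.lift_<w>`; plugging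
them into `L494.lift494` discharges its hypotheses. This is ONE orbit bound (`R_𝔽₂(T_494) ≥ 20`, the cell's certified lift
of Wang's printed 19), not a bound on `R_𝔽₂(⟨3,3,3⟩)`; no summit claim. It is the `h494` antecedent of p1's
`rankGe21F2_of_lifts8`.
-/

set_option autoImplicit false

namespace Summit.Ventures.MM22.ProfileCert.L494

open Summit.MatrixMultiplication.OmegaCensus.GF2RankLB Summit.Ventures.MM22.GF2Cert

/-- **Orbit 494 of Wang's `⟨3,3,3⟩/𝔽₂` table needs ≥ 20 products** (`Cert 3 3 3 [84] 20`), unconditionally: the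
sub-instance PROFILE-CERT kernel replay `lift494` with its four plane hypotheses discharged by `Lift333.lift_487/488/490/491`. -/
theorem lift494_holds : Cert 3 3 3 [84] 20 :=
  lift494 Lift333.lift_487 Lift333.lift_488 Lift333.lift_490 Lift333.lift_491

end Summit.Ventures.MM22.ProfileCert.L494
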